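import Mathlib.RingTheory.MvPolynomial.Homogeneous
import Mathlib.Algebra.MvPolynomial.Monad
import Mathlib.RingTheory.LocalRing.ResidueField.Basic
import Mathlib.RingTheory.Ideal.Operations
import HarnessLib

/-!
# hEv leaf [B] — kernel piece 2: ASSEMBLY at the earlier member via homogenised evaluation
# (Theses-free, def-free)

OURS (campaign `res-hironaka`, rung L ★L-G4, slot W4.1 · crux `Steer` (stmt-ResolutionOfSingularities-16345) · hEv leaf object
[B] = `BinaryResidueBackward` + `TangentialNeedsBinary` of res-L0-w41-idea-2's `HEV-IDEA-2.md` §2, kernel owner res-type-028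
(RULING 153a)). Not a statement of the manuscript under review [claim: Hironaka2017, status: under-review]; AI-produced, weaker
than expert review.

THE SETTING. `S` is the EARLIER member of a point window (a local ring), `ι : S → T` an injective ring map into a commutative
ring (the field `L`), `x ∈ 𝔪_S` the exceptional parameter of the window, `u : Fin n → 𝔪_S` the adapted parameters with
`ι(u_j) = ι(x) · u'_j` (`u'_j = u_j / x`, the affine coordinates of the chart), `C ∈ S[T₁…T_n]` of total degree `≤ d = 2e`
with `ι(F) = ι(x)^d · C(u')` (`F = f - g₀²` the cleaned radicand, `C` its dehomogenised initial form, `C(u') = f'`).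

* §1 lifting `κ`-polynomials to `S`-polynomials with the same support (`exists_map_eq_support_subset`).
* §2 HOMOGENISED EVALUATION `Σ_β G_β · x^(N − |β|) · u^β`: it is `ι(x)^N · G(u')` under `ι` (`map_sum_homogenised_eq`) and lies
  in `𝔪^(N+1)` when the coefficients of `G` lie in `𝔪` (`sum_homogenised_mem_pow`); scaling of forms (`eval₂_smul_eq`).
* §3 **`exists_sub_sq_mem_sup_of_map_residue_eq`**: if the reduction of `C` is `q² + R(ℓ₁,…,ℓ_m)` in `κ[T]` (output of piece 1,
  `…BinaryResidueRestriction.eq_sq_add_bind₁_of_sub_sq_mem`), `ℓ_k = Σ_j c_{kj} T_j`, then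
  `F - G² ∈ (Σ_j a_{1j} u_j, …, Σ_j a_{mj} u_j)^d + 𝔪_S^(d+1)` for some `G ∈ S` and lifts `a_{kj}` of the `c_{kj}` — i.e.
  `f - (g₀ + G)²` has an `m`-ary residue at `S` (in characteristic `2`).
[folklore]
-/

noncomputable section

-- `Summit.<S>.<S>.…` duplicates the summit name by design (single-problem summit).
set_option linter.dupNamespace false

open IsLocalRing MvPolynomial

namespace Summit.ResolutionOfSingularities.ResolutionOfSingularities.Theorems.SwitchingDichotomy.BinaryResidue

universe u v

/-! ## §1 Lifting polynomials along a surjection, support preserved -/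

section lift

variable {σ : Type*} {A : Type u} {B : Type v} [CommRing A] [CommRing B]

/-- A polynomial over `B` lifts along a surjection `A → B` to a polynomial with support inside the original support
(lift coefficient by coefficient). [folklore] -/
theorem exists_map_eq_support_subset (f : A →+* B) (hf : Function.Surjective f) (p : MvPolynomial σ B) :
    ∃ P : MvPolynomial σ A, map f P = p ∧ P.support ⊆ p.support := by
  classical
  choose g hg using hf
  refine ⟨∑ β ∈ p.support, monomial β (g (p.coeff β)), ?_, ?_⟩
  · rw [map_sum]
    simp_rw [map_monomial, hg]
    exact p.support_sum_monomial_coeff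
  · intro β hβ
    rw [mem_support_iff, coeff_sum] at hβ
    by_contra hβp
    apply hβ
    refine Finset.sum_eq_zero fun γ hγ => ?_
    rw [coeff_monomial, if_neg]
    rintro rfl
    exact hβp hγ

/-- Degree-controlled lift. [folklore] -/
theorem exists_map_eq_totalDegree_le (f : A →+* B) (hf : Function.Surjective f) (p : MvPolynomial σ B) :
    ∃ P : MvPolynomial σ A, map f P = p ∧ P.totalDegree ≤ p.totalDegree := by
  obtain ⟨P, hP, hsupp⟩ := exists_map_eq_support_subset f hf p
  exact ⟨P, hP, Finset.sup_mono hsupp⟩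

/-- Homogeneity-preserving lift. [folklore] -/
theorem exists_map_eq_isHomogeneous (f : A →+* B) (hf : Function.Surjective f) {p : MvPolynomial σ B} {k : ℕ}
    (hp : p.IsHomogeneous k) : ∃ P : MvPolynomial σ A, map f P = p ∧ P.IsHomogeneous k := by
  obtain ⟨P, hP, hsupp⟩ := exists_map_eq_support_subset f hf p
  refine ⟨P, hP, fun β hβ => hp ?_⟩
  exact mem_support_iff.mp (hsupp (mem_support_iff.mpr hβ))

end lift

/-! ## §2 Homogenised evaluation and scaling of forms -/

section homogenised

variable {σ : Type*} {A : Type u} {T : Type v} [CommRing A] [CommRing T]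

/-- Scaling a form of degree `k`: `Φ(c·v) = c^k · Φ(v)`. [folklore] -/
theorem eval₂_smul_eq (ι : A →+* T) {Φ : MvPolynomial σ A} {k : ℕ} (hΦ : Φ.IsHomogeneous k) (c : T) (v : σ → T) :
    eval₂ ι (c • v) Φ = c ^ k * eval₂ ι v Φ := by
  classical
  rw [eval₂_eq, eval₂_eq, Finset.mul_sum]
  refine Finset.sum_congr rfl fun β hβ => ?_
  have hdeg : ∑ i ∈ β.support, β i = k := by
    have h := hΦ (mem_support_iff.mp hβ)
    rw [← h, Finsupp.weight_apply]
    simp [Finsupp.sum]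
  simp_rw [Pi.smul_apply, smul_eq_mul, mul_pow, Finset.prod_mul_distrib, Finset.prod_pow_eq_pow_sum, hdeg]
  ring

/-- A form of degree `d` evaluates into `(v)^d` (the `QuasiRegularSequences.eval_mem_span_pow` shape, kept local).
[folklore] -/
theorem eval_mem_span_range_pow {m : ℕ} (v : Fin m → A) {R' : MvPolynomial (Fin m) A} {d : ℕ}
    (hR' : R'.IsHomogeneous d) : eval v R' ∈ Ideal.span (Set.range v) ^ d := by
  classical
  rw [R'.as_sum, map_sum]
  refine Ideal.sum_mem _ fun β hβ => ?_
  rw [eval_monomial]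
  refine Ideal.mul_mem_left _ _ ?_
  have hdeg : ∑ i ∈ β.support, β i = d := by
    have h := hR' (mem_support_iff.mp hβ)
    rw [← h, Finsupp.weight_apply]
    simp [Finsupp.sum]
  rw [Finsupp.prod, ← hdeg, ← Finset.prod_pow_eq_pow_sum]
  exact Ideal.prod_mem_prod fun j _ => Ideal.pow_mem_pow (Ideal.subset_span (Set.mem_range_self j)) _

/-- The homogenised evaluation `Σ_β G_β x^(N-|β|) u^β` maps under `ι` to `ι(x)^N · G(u')` when `ι(u_j) = ι(x)·u'_j` and
`deg G ≤ N`. [folklore] -/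
theorem map_sum_homogenised_eq (ι : A →+* T) (x : A) {n : ℕ} (u : Fin n → A) (u' : Fin n → T)
    (hu : ∀ j, ι (u j) = ι x * u' j) {N : ℕ} (G : MvPolynomial (Fin n) A) (hG : G.totalDegree ≤ N) :
    ι (∑ β ∈ G.support, G.coeff β * x ^ (N - β.degree) * β.prod fun j k => u j ^ k) =
      ι x ^ N * eval₂ ι u' G := by
  classical
  rw [map_sum, eval₂_eq, Finset.mul_sum]
  refine Finset.sum_congr rfl fun β hβ => ?_
  have hle : β.degree ≤ N := (le_totalDegree hβ : β.degree ≤ _).trans hG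
  rw [map_mul, map_mul, map_pow, Finsupp.prod, map_prod]
  simp_rw [map_pow, hu, mul_pow, Finset.prod_mul_distrib, Finset.prod_pow_eq_pow_sum]
  rw [show ∑ i ∈ β.support, β i = β.degree from rfl,
    show ι x ^ N = ι x ^ (N - β.degree) * ι x ^ β.degree by rw [← pow_add, Nat.sub_add_cancel hle]]
  ring

/-- The homogenised evaluation of a polynomial with coefficients in an ideal `I ∋ x, u_j` lies in `I^(N+1)`. [folklore] -/
theorem sum_homogenised_mem_pow (I : Ideal A) {x : A} (hx : x ∈ I) {n : ℕ} {u : Fin n → A} (hu : ∀ j, u j ∈ I)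
    {N : ℕ} (G : MvPolynomial (Fin n) A) (hG : G.totalDegree ≤ N) (h0 : ∀ β, G.coeff β ∈ I) :
    (∑ β ∈ G.support, G.coeff β * x ^ (N - β.degree) * β.prod fun j k => u j ^ k) ∈ I ^ (N + 1) := by
  classical
  refine Ideal.sum_mem _ fun β hβ => ?_
  have hle : β.degree ≤ N := (le_totalDegree hβ : β.degree ≤ _).trans hG
  have hprod : (β.prod fun j k => u j ^ k) ∈ I ^ β.degree := by
    rw [Finsupp.prod, show β.degree = ∑ i ∈ β.support, β i from rfl, ← Finset.prod_pow_eq_pow_sum]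
    exact Ideal.prod_mem_prod fun j _ => Ideal.pow_mem_pow (hu j) _
  have : I ^ (N + 1) = I * I ^ (N - β.degree) * I ^ β.degree := by
    rw [mul_assoc, ← pow_add, Nat.sub_add_cancel hle, pow_succ']
  rw [this]
  exact Ideal.mul_mem_mul (Ideal.mul_mem_mul (h0 β) (Ideal.pow_mem_pow hx _)) hprod

end homogenised

/-! ## §3 Assembly at the earlier member -/

section assembly

variable {S : Type u} {T : Type v} [CommRing S] [IsLocalRing S] [CommRing T]

/-- A linear form with coefficient vector `a`: `Σ_j a_j T_j` is homogeneous of degree one. [folklore] -/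
theorem isHomogeneous_one_sum_C_mul_X {A : Type*} [CommSemiring A] {n : ℕ} (a : Fin n → A) :
    (∑ j, MvPolynomial.C (a j) * X j : MvPolynomial (Fin n) A).IsHomogeneous 1 :=
  IsHomogeneous.sum _ _ _ fun j _ => (isHomogeneous_X A j).C_mul (a j)

/-- **Assembly.** In the setting of the module docstring, if the reduction of `C` modulo `𝔪_S` is
`q² + R(ℓ₁, …, ℓ_m)` with `deg q ≤ e`, `ℓ_k = Σ_j c_{kj} T_j` linear, `R` a `d`-form (`d = 2e`), then for lifts `a_{kj} ∈ S` of
the `c_{kj}` and some `G ∈ S`: `F - G² ∈ (Σ_j a_{1j} u_j, …, Σ_j a_{mj} u_j)^d + 𝔪_S^(d+1)`. (`G` = the homogenised evaluation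
of a lift of `q`; the error is the homogenised evaluation of `C - q̃² - R̃(ℓ̃)`, whose coefficients lie in `𝔪_S`.) [folklore] -/
theorem exists_sub_sq_mem_sup_of_map_residue_eq (ι : S →+* T) (hι : Function.Injective ι)
    {x : S} (hx : x ∈ maximalIdeal S) {n : ℕ} {u : Fin n → S} (hum : ∀ j, u j ∈ maximalIdeal S)
    (u' : Fin n → T) (hu : ∀ j, ι (u j) = ι x * u' j) {d e : ℕ} (hde : d = 2 * e)
    (C : MvPolynomial (Fin n) S) (hC : C.totalDegree ≤ d) (F : S) (hF : ι F = ι x ^ d * eval₂ ι u' C)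
    (q : MvPolynomial (Fin n) (ResidueField S)) (hq : q.totalDegree ≤ e) {m : ℕ}
    (c : Fin m → Fin n → ResidueField S)
    (R : MvPolynomial (Fin m) (ResidueField S)) (hR : R.IsHomogeneous d)
    (hid : map (residue S) C = q ^ 2 + bind₁ (fun k => ∑ j, MvPolynomial.C (c k j) * X j) R) :
    ∃ a : Fin m → Fin n → S, (∀ k j, residue S (a k j) = c k j) ∧
      ∃ G : S, F - G ^ 2 ∈ Ideal.span (Set.range fun k => ∑ j, a k j * u j) ^ d ⊔ maximalIdeal S ^ (d + 1) := by
  classical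
  have hsurj : Function.Surjective (residue S) := residue_surjective
  obtain ⟨q', hq'q, hq'⟩ := exists_map_eq_totalDegree_le (residue S) hsurj q
  obtain ⟨R', hR'R, hR'⟩ := exists_map_eq_isHomogeneous (residue S) hsurj hR
  choose a ha using fun k j => hsurj (c k j)
  refine ⟨a, ha, ?_⟩
  set ℓ' : Fin m → MvPolynomial (Fin n) S := fun k => ∑ j, MvPolynomial.C (a k j) * X j with hℓ'def
  have hℓ' : ∀ k, (ℓ' k).IsHomogeneous 1 := fun k => isHomogeneous_one_sum_C_mul_X (a k)
  have hℓ'ℓ : ∀ k, map (residue S) (ℓ' k) = ∑ j, MvPolynomial.C (c k j) * X j := fun k => by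
    simp only [hℓ'def, map_sum, map_mul, map_C, map_X, ha]
  -- the error polynomial
  set D : MvPolynomial (Fin n) S := C - (q' ^ 2 + bind₁ ℓ' R') with hD
  have hD0 : ∀ β, D.coeff β ∈ maximalIdeal S := by
    intro β
    rw [← residue_eq_zero_iff, ← coeff_map]
    have : map (residue S) D = 0 := by
      rw [hD, map_sub, map_add, map_pow, hq'q, map_bind₁, hR'R, hid]
      simp only [hℓ'ℓ]
      exact sub_eq_zero.mpr rfl
    rw [this, coeff_zero]
  have hDdeg : D.totalDegree ≤ d := by
    refine (totalDegree_sub _ _).trans (max_le hC ((totalDegree_add _ _).trans (max_le ?_ ?_)))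
    · refine (totalDegree_pow _ _).trans ?_
      rw [hde]; exact Nat.mul_le_mul_left 2 (hq'.trans hq)
    · have h := hR'.eval₂ (MvPolynomial.C : S →+* MvPolynomial (Fin n) S) ℓ' (fun r => isHomogeneous_C _ r) hℓ'
      rw [one_mul] at h
      have hb : (bind₁ ℓ' R').IsHomogeneous d := by
        simpa only [bind₁, aeval_def, algebraMap_eq, coe_eval₂Hom] using h
      exact hb.totalDegree_le
  -- the witnesses
  set G : S := ∑ β ∈ q'.support, q'.coeff β * x ^ (e - β.degree) * β.prod fun j k => u j ^ k with hG
  set w : S := ∑ β ∈ D.support, D.coeff β * x ^ (d - β.degree) * β.prod fun j k => u j ^ k with hw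
  set v : Fin m → S := fun k => eval u (ℓ' k) with hv
  have hvsum : (fun k => ∑ j, a k j * u j) = v := by
    funext k
    simp only [hv, hℓ'def, map_sum, map_mul, eval_C, eval_X]
  set y : S := eval v R' with hy
  have hwmem : w ∈ maximalIdeal S ^ (d + 1) := sum_homogenised_mem_pow _ hx hum D hDdeg hD0
  have hymem : y ∈ Ideal.span (Set.range v) ^ d := eval_mem_span_range_pow v hR'
  rw [hvsum]
  refine ⟨G, Submodule.mem_sup.mpr ⟨y, hymem, w, hwmem, ?_⟩⟩
  -- the identity `y + w = F - G²`, checked under the injection `ι`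
  apply hι
  have hGι : ι G = ι x ^ e * eval₂ ι u' q' := map_sum_homogenised_eq ι x u u' hu q' (hq'.trans hq)
  have hwι : ι w = ι x ^ d * eval₂ ι u' D := map_sum_homogenised_eq ι x u u' hu D hDdeg
  have hvι : ∀ i, ι (v i) = ι x * eval₂ ι u' (ℓ' i) := by
    intro i
    show ι (eval u (ℓ' i)) = _
    rw [show eval u (ℓ' i) = eval₂ (RingHom.id S) u (ℓ' i) from rfl, eval₂_comp_left, RingHom.comp_id,
      show (⇑ι ∘ u) = ι x • u' from funext fun j => by simp [hu], eval₂_smul_eq ι (hℓ' i), pow_one]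
  have hyι : ι y = ι x ^ d * eval₂ ι u' (bind₁ ℓ' R') := by
    rw [hy, show eval v R' = eval₂ (RingHom.id S) v R' from rfl, eval₂_comp_left, RingHom.comp_id,
      show (⇑ι ∘ v) = ι x • fun i => eval₂ ι u' (ℓ' i) from funext fun i => by simp [hvι],
      eval₂_smul_eq ι hR', show eval₂ ι u' (bind₁ ℓ' R') = eval₂Hom ι u' (bind₁ ℓ' R') from rfl, eval₂Hom_bind₁]
    rfl
  have hCι : eval₂ ι u' C = eval₂ ι u' q' ^ 2 + eval₂ ι u' (bind₁ ℓ' R') + eval₂ ι u' D := by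
    rw [hD]; simp only [eval₂_sub, eval₂_add, eval₂_pow]; ring
  rw [map_add, map_sub, map_pow, hyι, hwι, hF, hGι, hCι, hde]
  have : (ι x ^ e * eval₂ ι u' q') ^ 2 = ι x ^ (2 * e) * eval₂ ι u' q' ^ 2 := by ring
  rw [this]; ring

end assembly

end Summit.ResolutionOfSingularities.ResolutionOfSingularities.Theorems.SwitchingDichotomy.BinaryResidue

end
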